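import Summits.QuantumFields.YangMills.Theorems.BalabanLadderNTClassicalShadowTwoValleyPerm
import HarnessLib

/-!
# Crux `NT` (stmt-QuantumFields-19353), stub `stub_refpkgT : RefPkgT`: THE CLASSICAL SHADOW, IV — the symmetric THREE-valley test:
# clause 3 prices a `ℤ₃`-broken ground state of a frustrated femto box by the third central moment of its valley densities

Helper file (`--supports stmt-QuantumFields-19353`) of the fleet lead prover of crux `NT` (unit `ym-spine-19353-p1`, GEN 14); sequel
of `…NTClassicalShadowTwoValley[Perm]` (p599572, p600244).

THE MECHANISM.  A symmetric TWO-valley ground state has a vanishing zero-temperature third cumulant (the limit law is the symmetric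
two-point law), so clause 3 (E3-osc) does not see it.  The next case does: let a coordinate permutation `σ` fix the cube base and the
exterior `η`, and let `x, y = σ·x, z = σ·y` be three sites with `σ·z = x` (a `σ`-orbit of length three, e.g. `σ` the 3-cycle of the
spatial axes for an exterior depending on `x₀` only and isotropic in `x₁, x₂, x₃`).  Suppose the ground states of `η` form three valleys
permuted cyclically by `σ`, i.e. on `cubeMinimisers c b η` the three elementary symmetric functions of `(dens_x, dens_y, dens_z)` are
constants `e₁, e₂, e₃` (valley values `(a, b, c)`, `(b, c, a)`, `(c, a, b)`).  Then, whatever the zero-temperature mass split,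

* §1 `kerE_perm_symm_fun`, `kerE_dens_mul_perm_symm` — the kernel symmetries supplied by `σ` (one- and two-point);
* §2 **`tendsto_kerK3_of_threeValley`** — `kerK3^η_β(x, y, z) → e₃ − e₁e₂/3 + 2(e₁/3)³ = (a − m)(b − m)(c − m)`, `m = (a+b+c)/3`
  (`tendsto_kerE_dens_of_threeValley`: `kerE(dens_x) → e₁/3`; `tendsto_kerE_dens_mul_of_threeValley`: `kerE(dens_x dens_y) → e₂/3`);
* §3 **`cum3_le_of_e3osc_threeValley`** — clause 3 (registered shape, `a → 0`, `ℓ > 0`, constant `C₃`) forces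
  **`|e₃ − e₁e₂/3 + 2(e₁/3)³| ≤ C₃ / min(d_x,d_y,d_z)⁴ / (1 + min(‖y−x‖, ‖z−y‖, ‖z−x‖))⁸`**: a `ℤ₃`-broken ground state with valley
  densities `a, b, c` at mutual separation `n` and depth `d` COSTS `|(a−m)(b−m)(c−m)|·d⁴(1+n)⁸` units of `C₃`.

HONEST FRAMING.  Consequences of the registered clauses at fixed lattice geometry as `β → ∞`; necessary conditions on instances; nothing
here asserts that a three-valley exterior exists; no floor, not AF, not NT, not the seam, not the gap; not Clay.
-/

set_option autoImplicit false

noncomputable section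

open MeasureTheory Filter Topology
open Literature.MathematicalPhysics.QuantumFieldTheory Literature.MathematicalPhysics.QuantumLattice
open Literature.Probability.LatticeModels
open Summit.QuantumFields.YangMills.Cruxes.OSLegsFromFemtoAndGap.DlrCollarTransfer
open Summit.QuantumFields.YangMills.Cruxes.UVSeamRec.BoundaryLawPenetration
open Summit.QuantumFields.YangMills.Theorems.OSLegsFromFemtoAndGap.StubLower (integrable_of_continuous_compact)

namespace Summit.QuantumFields.YangMills.Cruxes.NT.ClassicalShadow

variable {G : Type} [Group G] [TopologicalSpace G] [IsTopologicalGroup G] [CompactSpace G]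
  [MeasurableSpace G] [BorelSpace G] (r : LatticeRep G)

/-! ## §1 Kernel symmetries supplied by a coordinate permutation -/

/-- If `σ` fixes the cube base and the exterior then `kerE^η_β(F ∘ σ) = kerE^η_β(F)` for every observable `F`. [folklore] -/
theorem kerE_perm_symm_fun (σ : Equiv.Perm (Fin 4)) (β : ℝ) {c : Fin 4 → ℤ} (hc : sitePerm σ c = c) (b : ℕ)
    {η : LGConfig 4 G} (hη : relabelConfig (edgePerm σ) η = η) (F : LGConfig 4 G → ℝ) :
    kerE G r β c b η (F ∘ relabelConfig (edgePerm σ)) = kerE G r β c b η F := by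
  have h := Summit.QuantumFields.YangMills.Cruxes.NT.BoundaryLaw.kerE_perm G r σ β c b η F
  rw [hc, hη] at h
  exact h.symm

/-- Two-point kernel symmetry: `kerE^η_β(dens_{σx}·dens_{σy}) = kerE^η_β(dens_x·dens_y)`. [folklore] -/
theorem kerE_dens_mul_perm_symm (σ : Equiv.Perm (Fin 4)) (β : ℝ) {c : Fin 4 → ℤ} (hc : sitePerm σ c = c) (b : ℕ)
    {η : LGConfig 4 G} (hη : relabelConfig (edgePerm σ) η = η) (x y : Fin 4 → ℤ) :
    kerE G r β c b η (fun U => dens G r (sitePerm σ x) U * dens G r (sitePerm σ y) U) =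
      kerE G r β c b η (fun U => dens G r x U * dens G r y U) := by
  rw [← kerE_perm_symm_fun r σ β hc b hη (fun U => dens G r (sitePerm σ x) U * dens G r (sitePerm σ y) U)]
  congr 1
  funext U
  simp only [Function.comp_apply, dens_perm]

/-! ## §2 Zero-temperature kernel means of a symmetric three-valley exterior -/

section ThreeValley

variable (c : Fin 4 → ℤ) (b : ℕ) (η : LGConfig 4 G) {x y z : Fin 4 → ℤ} {e₁ e₂ e₃ : ℝ}

/-- Linearity: `kerE(F₁ + F₂ + F₃) = kerE F₁ + kerE F₂ + kerE F₃` for continuous observables. [folklore] -/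
theorem kerE_add_three (β : ℝ) {F₁ F₂ F₃ : LGConfig 4 G → ℝ} (h₁ : Continuous F₁) (h₂ : Continuous F₂) (h₃ : Continuous F₃) :
    kerE G r β c b η (fun U => F₁ U + F₂ U + F₃ U) = kerE G r β c b η F₁ + kerE G r β c b η F₂ + kerE G r β c b η F₃ := by
  haveI : SecondCountableTopology G := (Continuous.isClosedEmbedding r.continuous r.injective).isEmbedding.secondCountableTopology
  haveI := isProbabilityMeasure_ymSpecification r.ρ r.continuous β (cubeEdges c b) η
  unfold kerE
  have i₁ : Integrable F₁ (ymSpecification r.ρ β (cubeEdges c b) η) := integrable_of_continuous_compact h₁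
  have i₂ : Integrable F₂ (ymSpecification r.ρ β (cubeEdges c b) η) := integrable_of_continuous_compact h₂
  have i₃ : Integrable F₃ (ymSpecification r.ρ β (cubeEdges c b) η) := integrable_of_continuous_compact h₃
  have i₁₂ : Integrable (fun U => F₁ U + F₂ U) (ymSpecification r.ρ β (cubeEdges c b) η) := i₁.add i₂
  rw [integral_add i₁₂ i₃, integral_add i₁ i₂]

/-- **One-point mean of a symmetric three-valley exterior**: `kerE^η_β(dens_x) → e₁/3`. [folklore] -/
theorem tendsto_kerE_dens_of_threeValley
    (he₁ : ∀ ζ ∈ cubeMinimisers G r c b η, dens G r x (glueWith (cubeEdges c b) ζ η) + dens G r y (glueWith (cubeEdges c b) ζ η) +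
      dens G r z (glueWith (cubeEdges c b) ζ η) = e₁)
    (hxy : ∀ β : ℝ, kerE G r β c b η (dens G r x) = kerE G r β c b η (dens G r y))
    (hxz : ∀ β : ℝ, kerE G r β c b η (dens G r x) = kerE G r β c b η (dens G r z)) :
    Tendsto (fun β : ℝ => kerE G r β c b η (dens G r x)) atTop (𝓝 (e₁ / 3)) := by
  have h : Tendsto (fun β : ℝ => kerE G r β c b η (fun U => dens G r x U + dens G r y U + dens G r z U)) atTop (𝓝 e₁) :=
    tendsto_kerE_of_eq_on_cubeMinimisers r c b η
      (((continuous_dens r x).add (continuous_dens r y)).add (continuous_dens r z)) he₁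
  have e : ∀ β : ℝ, kerE G r β c b η (dens G r x) =
      kerE G r β c b η (fun U => dens G r x U + dens G r y U + dens G r z U) / 3 := fun β => by
    rw [kerE_add_three r c b η β (continuous_dens r x) (continuous_dens r y) (continuous_dens r z), ← hxy β, ← hxz β]; ring
  simp_rw [e]
  exact h.div_const 3

/-- **Two-point mean of a symmetric three-valley exterior**: `kerE^η_β(dens_x·dens_y) → e₂/3`. [folklore] -/
theorem tendsto_kerE_dens_mul_of_threeValley
    (he₂ : ∀ ζ ∈ cubeMinimisers G r c b η,
      dens G r x (glueWith (cubeEdges c b) ζ η) * dens G r y (glueWith (cubeEdges c b) ζ η) +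
        dens G r y (glueWith (cubeEdges c b) ζ η) * dens G r z (glueWith (cubeEdges c b) ζ η) +
        dens G r z (glueWith (cubeEdges c b) ζ η) * dens G r x (glueWith (cubeEdges c b) ζ η) = e₂)
    (hxy_yz : ∀ β : ℝ, kerE G r β c b η (fun U => dens G r x U * dens G r y U) = kerE G r β c b η (fun U => dens G r y U * dens G r z U))
    (hxy_zx : ∀ β : ℝ, kerE G r β c b η (fun U => dens G r x U * dens G r y U) = kerE G r β c b η (fun U => dens G r z U * dens G r x U)) :
    Tendsto (fun β : ℝ => kerE G r β c b η (fun U => dens G r x U * dens G r y U)) atTop (𝓝 (e₂ / 3)) := by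
  have hc1 : Continuous fun U => dens G r x U * dens G r y U := (continuous_dens r x).mul (continuous_dens r y)
  have hc2 : Continuous fun U => dens G r y U * dens G r z U := (continuous_dens r y).mul (continuous_dens r z)
  have hc3 : Continuous fun U => dens G r z U * dens G r x U := (continuous_dens r z).mul (continuous_dens r x)
  have h : Tendsto (fun β : ℝ => kerE G r β c b η
      (fun U => dens G r x U * dens G r y U + dens G r y U * dens G r z U + dens G r z U * dens G r x U)) atTop (𝓝 e₂) :=
    tendsto_kerE_of_eq_on_cubeMinimisers r c b η ((hc1.add hc2).add hc3) he₂
  have e : ∀ β : ℝ, kerE G r β c b η (fun U => dens G r x U * dens G r y U) =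
      kerE G r β c b η (fun U => dens G r x U * dens G r y U + dens G r y U * dens G r z U + dens G r z U * dens G r x U) / 3 :=
    fun β => by rw [kerE_add_three r c b η β hc1 hc2 hc3, ← hxy_yz β, ← hxy_zx β]; ring
  simp_rw [e]
  exact h.div_const 3

/-- **The conditional third cumulant of a symmetric three-valley exterior**:
`kerK3^η_β(x, y, z) → e₃ − e₁e₂/3 + 2(e₁/3)³` (`= (a−m)(b−m)(c−m)` for valley densities `a, b, c` with mean `m`). [folklore] -/
theorem tendsto_kerK3_of_threeValley
    (he₁ : ∀ ζ ∈ cubeMinimisers G r c b η, dens G r x (glueWith (cubeEdges c b) ζ η) + dens G r y (glueWith (cubeEdges c b) ζ η) +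
      dens G r z (glueWith (cubeEdges c b) ζ η) = e₁)
    (he₂ : ∀ ζ ∈ cubeMinimisers G r c b η,
      dens G r x (glueWith (cubeEdges c b) ζ η) * dens G r y (glueWith (cubeEdges c b) ζ η) +
        dens G r y (glueWith (cubeEdges c b) ζ η) * dens G r z (glueWith (cubeEdges c b) ζ η) +
        dens G r z (glueWith (cubeEdges c b) ζ η) * dens G r x (glueWith (cubeEdges c b) ζ η) = e₂)
    (he₃ : ∀ ζ ∈ cubeMinimisers G r c b η,
      dens G r x (glueWith (cubeEdges c b) ζ η) * dens G r y (glueWith (cubeEdges c b) ζ η) *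
        dens G r z (glueWith (cubeEdges c b) ζ η) = e₃)
    (hxy : ∀ β : ℝ, kerE G r β c b η (dens G r x) = kerE G r β c b η (dens G r y))
    (hxz : ∀ β : ℝ, kerE G r β c b η (dens G r x) = kerE G r β c b η (dens G r z))
    (hxy_yz : ∀ β : ℝ, kerE G r β c b η (fun U => dens G r x U * dens G r y U) = kerE G r β c b η (fun U => dens G r y U * dens G r z U))
    (hxy_zx : ∀ β : ℝ, kerE G r β c b η (fun U => dens G r x U * dens G r y U) = kerE G r β c b η (fun U => dens G r z U * dens G r x U)) :
    Tendsto (fun β : ℝ => kerK3 G r β c b η x y z) atTop (𝓝 (e₃ - e₁ * e₂ / 3 + 2 * (e₁ / 3) ^ 3)) := by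
  have h3 : Tendsto (fun β : ℝ => kerE G r β c b η (fun U => dens G r x U * dens G r y U * dens G r z U)) atTop (𝓝 e₃) :=
    tendsto_kerE_of_eq_on_cubeMinimisers r c b η
      (((continuous_dens r x).mul (continuous_dens r y)).mul (continuous_dens r z)) he₃
  have hX := tendsto_kerE_dens_of_threeValley r c b η he₁ hxy hxz
  have hY : Tendsto (fun β : ℝ => kerE G r β c b η (dens G r y)) atTop (𝓝 (e₁ / 3)) := hX.congr' (Eventually.of_forall hxy)
  have hZ : Tendsto (fun β : ℝ => kerE G r β c b η (dens G r z)) atTop (𝓝 (e₁ / 3)) := hX.congr' (Eventually.of_forall hxz)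
  have hXY := tendsto_kerE_dens_mul_of_threeValley r c b η he₂ hxy_yz hxy_zx
  have hYZ : Tendsto (fun β : ℝ => kerE G r β c b η (fun U => dens G r y U * dens G r z U)) atTop (𝓝 (e₂ / 3)) :=
    hXY.congr' (Eventually.of_forall hxy_yz)
  have hXZ : Tendsto (fun β : ℝ => kerE G r β c b η (fun U => dens G r x U * dens G r z U)) atTop (𝓝 (e₂ / 3)) := by
    refine hXY.congr' (Eventually.of_forall fun β => ?_)
    rw [hxy_zx β]
    congr 1; funext U; ring
  have h := (((h3.sub (hX.mul hYZ)).sub (hY.mul hXZ)).sub (hZ.mul hXY)).add ((hX.mul hY).mul hZ |>.const_mul 2)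
  have e : e₃ - e₁ / 3 * (e₂ / 3) - e₁ / 3 * (e₂ / 3) - e₁ / 3 * (e₂ / 3) + 2 * (e₁ / 3 * (e₁ / 3) * (e₁ / 3)) =
      e₃ - e₁ * e₂ / 3 + 2 * (e₁ / 3) ^ 3 := by ring
  rw [e] at h
  refine h.congr' (Eventually.of_forall fun β => ?_)
  simp only [kerK3]

/-- The limit in valley coordinates: `e₃ − e₁e₂/3 + 2(e₁/3)³ = (a − m)(b − m)(c − m)`, `m = (a+b+c)/3`. [folklore] -/
theorem threeValley_cumulant_eq (a' b' c' : ℝ) :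
    a' * b' * c' - (a' + b' + c') * (a' * b' + b' * c' + c' * a') / 3 + 2 * ((a' + b' + c') / 3) ^ 3 =
      (a' - (a' + b' + c') / 3) * (b' - (a' + b' + c') / 3) * (c' - (a' + b' + c') / 3) := by
  ring

end ThreeValley

/-! ## §3 The price: clause 3 against the valley third moment -/

section Price

variable (a : ℝ → ℝ)

/-- **Clause 3 prices a symmetric three-valley exterior**:
`|e₃ − e₁e₂/3 + 2(e₁/3)³| ≤ C₃ / min(d_x,d_y,d_z)⁴ / (1 + min(‖y−x‖, ‖z−y‖, ‖z−x‖))⁸`. [folklore] -/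
theorem cum3_le_of_e3osc_threeValley (ha0 : Tendsto a atTop (𝓝 0)) {C₃ ℓ : ℝ} (hℓ : 0 < ℓ)
    (hE3 : ∃ β₃ : ℝ, ∀ β : ℝ, β₃ ≤ β → ∀ (c : Fin 4 → ℤ) (b : ℕ), (b : ℝ) * a β ≤ ℓ →
      ∀ (η η' : LGConfig 4 G) (x y z : Fin 4 → ℤ), 1 ≤ depth c b x → 1 ≤ depth c b y → 1 ≤ depth c b z →
        |kerK3 G r β c b η x y z - kerK3 G r β c b η' x y z| ≤
          C₃ / ((min (min (depth c b x) (depth c b y)) (depth c b z) : ℕ) : ℝ) ^ 4 /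
            (1 + min (min ‖siteToE (y - x)‖ ‖siteToE (z - y)‖) ‖siteToE (z - x)‖) ^ 8)
    (c : Fin 4 → ℤ) (b : ℕ) {x y z : Fin 4 → ℤ} (hx : 2 ≤ depth c b x) (hy : 2 ≤ depth c b y) (hz : 2 ≤ depth c b z)
    (η : LGConfig 4 G) {e₁ e₂ e₃ : ℝ}
    (he₁ : ∀ ζ ∈ cubeMinimisers G r c b η, dens G r x (glueWith (cubeEdges c b) ζ η) + dens G r y (glueWith (cubeEdges c b) ζ η) +
      dens G r z (glueWith (cubeEdges c b) ζ η) = e₁)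
    (he₂ : ∀ ζ ∈ cubeMinimisers G r c b η,
      dens G r x (glueWith (cubeEdges c b) ζ η) * dens G r y (glueWith (cubeEdges c b) ζ η) +
        dens G r y (glueWith (cubeEdges c b) ζ η) * dens G r z (glueWith (cubeEdges c b) ζ η) +
        dens G r z (glueWith (cubeEdges c b) ζ η) * dens G r x (glueWith (cubeEdges c b) ζ η) = e₂)
    (he₃ : ∀ ζ ∈ cubeMinimisers G r c b η,
      dens G r x (glueWith (cubeEdges c b) ζ η) * dens G r y (glueWith (cubeEdges c b) ζ η) *
        dens G r z (glueWith (cubeEdges c b) ζ η) = e₃)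
    (hxy : ∀ β : ℝ, kerE G r β c b η (dens G r x) = kerE G r β c b η (dens G r y))
    (hxz : ∀ β : ℝ, kerE G r β c b η (dens G r x) = kerE G r β c b η (dens G r z))
    (hxy_yz : ∀ β : ℝ, kerE G r β c b η (fun U => dens G r x U * dens G r y U) = kerE G r β c b η (fun U => dens G r y U * dens G r z U))
    (hxy_zx : ∀ β : ℝ, kerE G r β c b η (fun U => dens G r x U * dens G r y U) = kerE G r β c b η (fun U => dens G r z U * dens G r x U)) :
    |e₃ - e₁ * e₂ / 3 + 2 * (e₁ / 3) ^ 3| ≤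
      C₃ / ((min (min (depth c b x) (depth c b y)) (depth c b z) : ℕ) : ℝ) ^ 4 /
        (1 + min (min ‖siteToE (y - x)‖ ‖siteToE (z - y)‖) ‖siteToE (z - x)‖) ^ 8 := by
  obtain ⟨β₃, H3⟩ := hE3
  have hlim : Tendsto (fun β : ℝ => |kerK3 G r β c b η x y z - kerK3 G r β c b 1 x y z|) atTop
      (𝓝 |e₃ - e₁ * e₂ / 3 + 2 * (e₁ / 3) ^ 3|) := by
    have h := ((tendsto_kerK3_of_threeValley r c b η he₁ he₂ he₃ hxy hxz hxy_yz hxy_zx).sub (tendsto_kerK3_one r c b hx hy hz)).abs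
    rwa [sub_zero] at h
  refine le_of_tendsto hlim ?_
  filter_upwards [eventually_mul_le_of_tendsto_zero ha0 hℓ b, eventually_ge_atTop β₃] with β hb hβ3
  exact H3 β hβ3 c b hb η 1 x y z (le_trans one_le_two hx) (le_trans one_le_two hy) (le_trans one_le_two hz)

/-- **The `σ`-orbit form.**  `σ` fixes the cube base and the exterior, `y = σ·x`, `z = σ·y`, `σ·z = x` (an orbit of length three), all of
depth `≥ 2`, and the elementary symmetric functions of `(dens_x, dens_y, dens_z)` are constant on the ground states: then
`|e₃ − e₁e₂/3 + 2(e₁/3)³| ≤ C₃ / min(d)⁴ / (1 + min sep)⁸`. [folklore] -/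
theorem cum3_le_of_e3osc_permValley (ha0 : Tendsto a atTop (𝓝 0)) {C₃ ℓ : ℝ} (hℓ : 0 < ℓ)
    (hE3 : ∃ β₃ : ℝ, ∀ β : ℝ, β₃ ≤ β → ∀ (c : Fin 4 → ℤ) (b : ℕ), (b : ℝ) * a β ≤ ℓ →
      ∀ (η η' : LGConfig 4 G) (x y z : Fin 4 → ℤ), 1 ≤ depth c b x → 1 ≤ depth c b y → 1 ≤ depth c b z →
        |kerK3 G r β c b η x y z - kerK3 G r β c b η' x y z| ≤
          C₃ / ((min (min (depth c b x) (depth c b y)) (depth c b z) : ℕ) : ℝ) ^ 4 /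
            (1 + min (min ‖siteToE (y - x)‖ ‖siteToE (z - y)‖) ‖siteToE (z - x)‖) ^ 8)
    (σ : Equiv.Perm (Fin 4)) {c : Fin 4 → ℤ} (hc : sitePerm σ c = c) (b : ℕ) {η : LGConfig 4 G}
    (hη : relabelConfig (edgePerm σ) η = η) {x : Fin 4 → ℤ} (horbit : sitePerm σ (sitePerm σ (sitePerm σ x)) = x)
    (hx : 2 ≤ depth c b x) (hy : 2 ≤ depth c b (sitePerm σ x)) (hz : 2 ≤ depth c b (sitePerm σ (sitePerm σ x))) {e₁ e₂ e₃ : ℝ}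
    (he₁ : ∀ ζ ∈ cubeMinimisers G r c b η, dens G r x (glueWith (cubeEdges c b) ζ η) +
      dens G r (sitePerm σ x) (glueWith (cubeEdges c b) ζ η) + dens G r (sitePerm σ (sitePerm σ x)) (glueWith (cubeEdges c b) ζ η) = e₁)
    (he₂ : ∀ ζ ∈ cubeMinimisers G r c b η,
      dens G r x (glueWith (cubeEdges c b) ζ η) * dens G r (sitePerm σ x) (glueWith (cubeEdges c b) ζ η) +
        dens G r (sitePerm σ x) (glueWith (cubeEdges c b) ζ η) * dens G r (sitePerm σ (sitePerm σ x)) (glueWith (cubeEdges c b) ζ η) +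
        dens G r (sitePerm σ (sitePerm σ x)) (glueWith (cubeEdges c b) ζ η) * dens G r x (glueWith (cubeEdges c b) ζ η) = e₂)
    (he₃ : ∀ ζ ∈ cubeMinimisers G r c b η,
      dens G r x (glueWith (cubeEdges c b) ζ η) * dens G r (sitePerm σ x) (glueWith (cubeEdges c b) ζ η) *
        dens G r (sitePerm σ (sitePerm σ x)) (glueWith (cubeEdges c b) ζ η) = e₃) :
    |e₃ - e₁ * e₂ / 3 + 2 * (e₁ / 3) ^ 3| ≤
      C₃ / ((min (min (depth c b x) (depth c b (sitePerm σ x))) (depth c b (sitePerm σ (sitePerm σ x))) : ℕ) : ℝ) ^ 4 /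
        (1 + min (min ‖siteToE (sitePerm σ x - x)‖ ‖siteToE (sitePerm σ (sitePerm σ x) - sitePerm σ x)‖)
          ‖siteToE (sitePerm σ (sitePerm σ x) - x)‖) ^ 8 := by
  refine cum3_le_of_e3osc_threeValley r a ha0 hℓ hE3 c b hx hy hz η he₁ he₂ he₃ (fun β => ?_) (fun β => ?_) (fun β => ?_)
    (fun β => ?_)
  · exact (kerE_dens_perm_symm r σ β hc b hη x).symm
  · have h := kerE_dens_perm_symm r σ β hc b hη (sitePerm σ (sitePerm σ x))
    rw [horbit] at h
    exact h
  · exact (kerE_dens_mul_perm_symm r σ β hc b hη x (sitePerm σ x)).symm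
  · have h := kerE_dens_mul_perm_symm r σ β hc b hη (sitePerm σ (sitePerm σ x)) x
    rw [horbit] at h
    exact h

end Price

end Summit.QuantumFields.YangMills.Cruxes.NT.ClassicalShadow

end
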